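import Literature.AlgebraicGeometry.HodgeTheory.LefschetzDecompositionSingular
import Literature.AlgebraicGeometry.HodgeTheory.HodgeStructureOfHodgeModel
import Literature.NumberTheory.Transcendental.ComplexFormsMixedType
import HarnessLib

/-!
# Hodge-type projectors on `Hᵏ(X(ℂ); ℂ)` and their compatibility with a Lefschetz operator

Layer `Literature/AlgebraicGeometry/HodgeTheory`. For a Hodge model `A` of `X` the pieces
`H^{p,q}_A`, `p + q = k`, of `Hᵏ(X^an; ℂ)` form the Hodge decomposition (field
`HodgeModel.isInternal_hodgePQ`, Voisin I Thm. 6.18 / Prop. 6.11); transported along the bijective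
comparison `A^* : Hᵏ(X(ℂ); ℂ) ≅ Hᵏ(X^an; ℂ)` they give an internal direct sum decomposition of
`Hᵏ(X(ℂ); ℂ)` into the **type pieces** `A.typePiece k (p, q) = {c | A^* c ∈ H^{p,q}_A}`
(`HodgeModel.isInternal_typePiece`), with projections `A.typeProj k (p, q)` (the tree's
`internalProj`). Voisin I Rem. 6.27 / §7.1.2: a Lefschetz operator `L = η ∪ ·` "of bidegree `(1, 1)`
for the bigraduation of the cohomology given by the Hodge decomposition" commutes with the
projections up to the shift of types — `L ∘ π_{(p,q)} = π_{(p+1,q+1)} ∘ L`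
(`HodgeModel.lefschetzOperator_typeProj`) —, hence so does the "diagonal" family
`T^δ_a = ∑_{p-q=δ} π_{(p,q)}` (`HodgeModel.lefschetzOperator_typeProjDiff`), an additive family in
the sense of `map_internalProj_lefschetzSummand_of_commute` / `map_primitivePart_of_commute`: this
is how the Hodge types of the Lefschetz components and primitive parts of a class of pure type are
read off (brick B6 of the programme proving `smoothProjective_hodgeStructure_isPolarizable`).
No named facts are introduced (D-0026).

## References

* [VoisinHodgeI2002] C. Voisin, Hodge Theory and Complex Algebraic Geometry I (2002), §6.1.3
  Prop. 6.11, Thm. 6.18, §6.2.3 Rem. 6.27, §7.1.1–7.1.2.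
-/

noncomputable section

open CategoryTheory
open Literature.AlgebraicTopology.SingularHomology Literature.Geometry.Kaehler

namespace Literature.AlgebraicGeometry.HodgeTheory

section HodgeTheory

variable {n : ℕ} {X : Motives.SchemeOver ℂ}

namespace HodgeModel

variable (A : HodgeModel n X)

/-! ### The type pieces of `Hᵏ(X(ℂ); ℂ)` read in a Hodge model -/

/-- The **piece of type `(p, q)`** of `Hᵏ(X(ℂ); ℂ)` read in the Hodge model `A`: the classes
whose pull-back to `X^an` lies in `H^{p,q}_A` (so `c ∈ A.typePiece k (p, q)` is
`IsOfHodgeType n X k p q c` witnessed by `A`). Indexed by the antidiagonal `p + q = k`.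
[cite: VoisinHodgeI2002, §7.1.1] -/
def typePiece (k : ℕ) (pq : ↥(Finset.HasAntidiagonal.antidiagonal k)) : Submodule ℂ (complexBetti X k) :=
  (A.hodgePQ k pq.1.1 pq.1.2).comap (A.pullbackEquiv k).toLinearMap

/-- Membership in a type piece is membership of the pull-back in `H^{p,q}_A`. [folklore] -/
theorem mem_typePiece_iff {k : ℕ} (pq : ↥(Finset.HasAntidiagonal.antidiagonal k)) (c : complexBetti X k) :
    c ∈ A.typePiece k pq ↔ A.pullback k c ∈ A.hodgePQ k pq.1.1 pq.1.2 :=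
  Iff.rfl

/-- A class in a type piece is of that Hodge type. [cite: VoisinHodgeI2002, §7.1.1] -/
theorem isOfHodgeType_of_mem_typePiece {k : ℕ} {pq : ↥(Finset.HasAntidiagonal.antidiagonal k)} {c : complexBetti X k}
    (hc : c ∈ A.typePiece k pq) : IsOfHodgeType n X k pq.1.1 pq.1.2 c :=
  ⟨A, hc⟩

/-- With `hodgePQ_independent_of_hodgeModel` (a theorem of the tree,
`hodgePQ_independent_of_hodgeModel_holds`), a class of Hodge type `(p, q)` — witnessed by ANY model —
lies in the type piece of `A`. [cite: VoisinHodgeI2002, Prop. 6.11 and §7.1.1] -/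
theorem mem_typePiece_of_isOfHodgeType (hI : hodgePQ_independent_of_hodgeModel)
    (hX : Motives.IsSmoothProjective n X) {k p q : ℕ} (hpq : (p, q) ∈ Finset.HasAntidiagonal.antidiagonal k)
    {c : complexBetti X k} (hc : IsOfHodgeType n X k p q c) : c ∈ A.typePiece k ⟨(p, q), hpq⟩ :=
  (hodgePQ_independent_of_hodgeModel.isOfHodgeType_iff hI hX A).1 hc

/-- **No classes of type `(p, q)` with `p > n = dim X`**: the type piece `(p, q)` of `Hᵏ(X(ℂ); ℂ)`
is `0` for `p > n` (there are no forms of type `(p, q)` on the `n`-dimensional `X^an`,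
`hodgePQ_eq_bot_of_finrank_lt_fst`). [cite: VoisinHodgeI2002, §2.3.1 and §6.1] -/
theorem typePiece_eq_bot_of_lt_fst {k : ℕ} (pq : ↥(Finset.HasAntidiagonal.antidiagonal k)) (hp : n < pq.1.1) :
    A.typePiece k pq = ⊥ := by
  have hbot : A.hodgePQ k pq.1.1 pq.1.2 = ⊥ :=
    (A.hodgePQ_eq_bot_iff k pq.1.1 pq.1.2).2
      (Literature.NumberTheory.Transcendental.hodgePQ_eq_bot_of_finrank_lt_fst A.carrier
        (by rw [A.isAnalytification.finrank_eq]; exact hp))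
  rw [typePiece, hbot, Submodule.comap_bot, LinearEquiv.ker]

/-- No classes of type `(p, q)` with `q > n = dim X`. [cite: VoisinHodgeI2002, §2.3.1 and §6.1] -/
theorem typePiece_eq_bot_of_lt_snd {k : ℕ} (pq : ↥(Finset.HasAntidiagonal.antidiagonal k)) (hq : n < pq.1.2) :
    A.typePiece k pq = ⊥ := by
  have hbot : A.hodgePQ k pq.1.1 pq.1.2 = ⊥ :=
    (A.hodgePQ_eq_bot_iff k pq.1.1 pq.1.2).2
      (Literature.NumberTheory.Transcendental.hodgePQ_eq_bot_of_finrank_lt_snd A.carrier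
        (by rw [A.isAnalytification.finrank_eq]; exact hq))
  rw [typePiece, hbot, Submodule.comap_bot, LinearEquiv.ker]

/-- The type piece is the image of the de Rham piece `H^{p,q}_dR(X^an)` under
`(A^*)⁻¹ ∘ e_A : H^k_dR(X^an; ℂ) ≅ Hᵏ(X(ℂ); ℂ)`. [folklore] -/
theorem typePiece_eq_map (k : ℕ) (pq : ↥(Finset.HasAntidiagonal.antidiagonal k)) :
    A.typePiece k pq =
      (Literature.NumberTheory.Transcendental.hodgePQ A.model A.carrier k pq.1.1 pq.1.2).map
        ((A.deRham A.carrier k).trans (A.pullbackEquiv k).symm).toLinearMap := by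
  rw [typePiece, LinearEquiv.coe_trans, Submodule.map_comp]
  change _ = Submodule.map (A.pullbackEquiv k).symm.toLinearMap (A.hodgePQ k pq.1.1 pq.1.2)
  rw [Submodule.map_equiv_eq_comap_symm, LinearEquiv.symm_symm]

/-- **The type pieces decompose `Hᵏ(X(ℂ); ℂ)` as an internal direct sum** (the Hodge
decomposition of the model, `isInternal_hodgePQ`, transported along `(A^*)⁻¹ ∘ e_A`).
[cite: VoisinHodgeI2002, Thm. 6.18 and §7.1.1] -/
theorem isInternal_typePiece (k : ℕ) : DirectSum.IsInternal (A.typePiece k) := by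
  set e := (A.deRham A.carrier k).trans (A.pullbackEquiv k).symm with he
  have hfun : A.typePiece k = fun pq ↦
      (Literature.NumberTheory.Transcendental.hodgePQ A.model A.carrier k pq.1.1 pq.1.2).map
        e.toLinearMap := funext fun pq ↦ A.typePiece_eq_map k pq
  rw [hfun, DirectSum.isInternal_submodule_iff_iSupIndep_and_iSup_eq_top]
  have h := A.isInternal_hodgePQ k
  rw [DirectSum.isInternal_submodule_iff_iSupIndep_and_iSup_eq_top] at h
  refine ⟨?_, ?_⟩
  · have hcomp : (fun pq : ↥(Finset.HasAntidiagonal.antidiagonal k) ↦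
        (Literature.NumberTheory.Transcendental.hodgePQ A.model A.carrier k pq.1.1 pq.1.2).map
          e.toLinearMap) = (Submodule.orderIsoMapComap e) ∘ fun pq : ↥(Finset.HasAntidiagonal.antidiagonal k) ↦
          Literature.NumberTheory.Transcendental.hodgePQ A.model A.carrier k pq.1.1 pq.1.2 := rfl
    rw [hcomp, iSupIndep_map_orderIso_iff]
    exact h.1
  · rw [← Submodule.map_iSup, h.2, Submodule.map_top, LinearEquiv.range]

/-! ### The type projectors -/

/-- The **projector onto the type-`(p, q)` piece** of `Hᵏ(X(ℂ); ℂ)` read in `A` (the tree's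
`internalProj` of the internal direct sum `isInternal_typePiece`). [cite: VoisinHodgeI2002, §7.1.1] -/
def typeProj (k : ℕ) (pq : ↥(Finset.HasAntidiagonal.antidiagonal k)) : complexBetti X k →ₗ[ℂ] complexBetti X k :=
  internalProj (A.isInternal_typePiece k) pq

/-- The type projector lands in its type piece. [folklore] -/
theorem typeProj_mem (k : ℕ) (pq : ↥(Finset.HasAntidiagonal.antidiagonal k)) (c : complexBetti X k) :
    A.typeProj k pq c ∈ A.typePiece k pq :=
  internalProj_mem _ pq c

/-- `∑_{p+q=k} π_{(p,q)} c = c`. [cite: VoisinHodgeI2002, Thm. 6.18 and §7.1.1] -/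
theorem sum_typeProj (k : ℕ) (c : complexBetti X k) : ∑ pq, A.typeProj k pq c = c :=
  sum_internalProj _ c

/-- On its piece the projector is the identity. [folklore] -/
theorem typeProj_apply_of_mem {k : ℕ} {pq : ↥(Finset.HasAntidiagonal.antidiagonal k)} {c : complexBetti X k}
    (hc : c ∈ A.typePiece k pq) : A.typeProj k pq c = c :=
  internalProj_apply_of_mem _ hc

/-- On the other pieces the projector vanishes. [folklore] -/
theorem typeProj_apply_of_mem_ne {k : ℕ} {pq pq' : ↥(Finset.HasAntidiagonal.antidiagonal k)} (h : pq ≠ pq')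
    {c : complexBetti X k} (hc : c ∈ A.typePiece k pq) : A.typeProj k pq' c = 0 :=
  internalProj_apply_of_mem_ne _ h hc

/-- Uniqueness of the type decomposition: if `c = ∑ y_{(p,q)}` with `y_{(p,q)}` of type `(p, q)` then
`π_{(p,q)} c = y_{(p,q)}`. [cite: VoisinHodgeI2002, Thm. 6.18] -/
theorem typeProj_eq_of_sum_eq {k : ℕ} {y : ↥(Finset.HasAntidiagonal.antidiagonal k) → complexBetti X k}
    (hy : ∀ pq, y pq ∈ A.typePiece k pq) {c : complexBetti X k} (hc : ∑ pq, y pq = c)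
    (pq : ↥(Finset.HasAntidiagonal.antidiagonal k)) : A.typeProj k pq c = y pq :=
  internalProj_eq_of_sum_eq _ hy hc pq

/-! ### Compatibility with a Lefschetz operator of bidegree `(1, 1)` -/

/-- The shift `(p, q) ↦ (p + 1, q + 1)` from the antidiagonal of `k` to that of `l = 2 + k`. [folklore] -/
def typeShift {k l : ℕ} (hkl : 2 + k = l) (pq : ↥(Finset.HasAntidiagonal.antidiagonal k)) : ↥(Finset.HasAntidiagonal.antidiagonal l) :=
  ⟨(pq.1.1 + 1, pq.1.2 + 1), Finset.HasAntidiagonal.mem_antidiagonal.2 (by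
    have := Finset.HasAntidiagonal.mem_antidiagonal.1 pq.2; omega)⟩

/-- The shift of types is injective. [folklore] -/
theorem typeShift_injective {k l : ℕ} (hkl : 2 + k = l) : Function.Injective (typeShift (k := k) hkl) := by
  intro a b hab
  have h := congrArg Subtype.val hab
  simp only [typeShift, Prod.mk.injEq] at h
  exact Subtype.ext (Prod.ext (by omega) (by omega))

/-- **A Lefschetz operator of bidegree `(1, 1)` commutes with the type projectors up to the shift
of types**: if `L = η ∪ ·` maps `A`-type `(p, q)` to `A`-type `(p + 1, q + 1)` in all degrees, then
`L (π_{(p,q)} c) = π_{(p+1,q+1)} (L c)` (Voisin I Rem. 6.27: "`L` is of bidegree `(1, 1)` for the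
bigraduation given by the Hodge decomposition"; uniqueness of the decomposition of `L c`).
[cite: VoisinHodgeI2002, §6.2.3 Rem. 6.27 and §7.1.2] -/
theorem lefschetzOperator_typeProj {η : complexBetti X 2}
    (hη : ∀ (k l : ℕ) (hkl : 2 + k = l) (pq : ↥(Finset.HasAntidiagonal.antidiagonal k)) (c : complexBetti X k),
      c ∈ A.typePiece k pq → lefschetzOperator η hkl c ∈ A.typePiece l (typeShift hkl pq))
    {k l : ℕ} (hkl : 2 + k = l) (pq : ↥(Finset.HasAntidiagonal.antidiagonal k)) (c : complexBetti X k) :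
    lefschetzOperator η hkl (A.typeProj k pq c) = A.typeProj l (typeShift hkl pq) (lefschetzOperator η hkl c) := by
  classical
  -- the decomposition of `L c` along the shifted types
  let y : ↥(Finset.HasAntidiagonal.antidiagonal l) → complexBetti X l := fun i' ↦
    ∑ i ∈ Finset.univ.filter (fun i ↦ typeShift hkl i = i'), lefschetzOperator η hkl (A.typeProj k i c)
  have hy : ∀ i', y i' ∈ A.typePiece l i' := by
    intro i'
    refine Submodule.sum_mem _ fun i hi ↦ ?_
    rw [Finset.mem_filter] at hi
    rw [← hi.2]
    exact hη k l hkl i _ (A.typeProj_mem k i c)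
  have hsum : ∑ i', y i' = lefschetzOperator η hkl c := by
    rw [Finset.sum_fiberwise Finset.univ (typeShift hkl)
      (fun i ↦ lefschetzOperator η hkl (A.typeProj k i c)), ← map_sum, A.sum_typeProj]
  rw [A.typeProj_eq_of_sum_eq hy hsum (typeShift hkl pq)]
  -- the fibre of the shift over `typeShift pq` is `{pq}`
  change _ = ∑ i ∈ Finset.univ.filter (fun i ↦ typeShift hkl i = typeShift hkl pq),
    lefschetzOperator η hkl (A.typeProj k i c)
  rw [Finset.sum_eq_single pq]
  · intro i hi hipq
    rw [Finset.mem_filter] at hi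
    exact absurd (typeShift_injective hkl hi.2) hipq
  · intro h
    exact absurd (Finset.mem_filter.2 ⟨Finset.mem_univ pq, rfl⟩ :
      pq ∈ Finset.univ.filter (fun i ↦ typeShift hkl i = typeShift hkl pq)) h

/-! ### The diagonal families `T^δ_a = ∑_{p-q=δ} π_{(p,q)}` -/

/-- The **diagonal type projector** `T^δ_k = ∑_{p+q=k, p-q=δ} π_{(p,q)}` of `Hᵏ(X(ℂ); ℂ)` (at most
one term; `0` when `k` and `δ` have different parities or `|δ| > k`). The family `(T^δ_k)_k`
commutes with a Lefschetz operator of bidegree `(1, 1)`, the shift `(p, q) ↦ (p+1, q+1)` preserving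
`p - q`. [cite: VoisinHodgeI2002, §6.2.3 Rem. 6.27] -/
def typeProjDiff (k : ℕ) (δ : ℤ) : complexBetti X k →ₗ[ℂ] complexBetti X k :=
  ∑ pq : ↥(Finset.HasAntidiagonal.antidiagonal k), if (pq.1.1 : ℤ) - pq.1.2 = δ then A.typeProj k pq else 0

/-- On a class of pure type `(p, q)` the diagonal projector `T^{p-q}` is the identity.
[cite: VoisinHodgeI2002, §7.1.1] -/
theorem typeProjDiff_apply_of_mem {k : ℕ} {pq : ↥(Finset.HasAntidiagonal.antidiagonal k)} {c : complexBetti X k}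
    (hc : c ∈ A.typePiece k pq) : A.typeProjDiff k ((pq.1.1 : ℤ) - pq.1.2) c = c := by
  classical
  unfold typeProjDiff
  rw [LinearMap.sum_apply, Finset.sum_eq_single pq]
  · rw [if_pos rfl, A.typeProj_apply_of_mem hc]
  · intro pq' _ hne
    split_ifs with h
    · exact A.typeProj_apply_of_mem_ne hne.symm hc
    · rfl
  · intro h
    exact absurd (Finset.mem_univ pq) h

/-- The value of the diagonal projector lies in a single type piece: if `(p, q)` is the pair on the
antidiagonal of `k` with `p - q = δ` then `T^δ_k c = π_{(p,q)} c`. [folklore] -/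
theorem typeProjDiff_eq_typeProj {k : ℕ} {δ : ℤ} (pq : ↥(Finset.HasAntidiagonal.antidiagonal k))
    (hpq : (pq.1.1 : ℤ) - pq.1.2 = δ) (c : complexBetti X k) :
    A.typeProjDiff k δ c = A.typeProj k pq c := by
  classical
  unfold typeProjDiff
  rw [LinearMap.sum_apply, Finset.sum_eq_single pq]
  · rw [if_pos hpq]
  · intro pq' _ hne
    have hne' : ¬ ((pq'.1.1 : ℤ) - pq'.1.2 = δ) := by
      intro h
      apply hne
      have h1 := Finset.HasAntidiagonal.mem_antidiagonal.1 pq.2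
      have h2 := Finset.HasAntidiagonal.mem_antidiagonal.1 pq'.2
      exact Subtype.ext (Prod.ext (by omega) (by omega))
    rw [if_neg hne', LinearMap.zero_apply]
  · intro h
    exact absurd (Finset.mem_univ pq) h

/-- If no pair on the antidiagonal of `k` has `p - q = δ` then `T^δ_k = 0`. [folklore] -/
theorem typeProjDiff_eq_zero {k : ℕ} {δ : ℤ}
    (h : ∀ pq : ↥(Finset.HasAntidiagonal.antidiagonal k), (pq.1.1 : ℤ) - pq.1.2 ≠ δ) : A.typeProjDiff k δ = 0 := by
  unfold typeProjDiff
  exact Finset.sum_eq_zero fun pq _ ↦ if_neg (h pq)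

/-- The value of `T^δ_k` lies in the type piece `(p, q)` whenever `p + q = k`, `p - q = δ`. [folklore] -/
theorem typeProjDiff_mem {k : ℕ} {δ : ℤ} (pq : ↥(Finset.HasAntidiagonal.antidiagonal k))
    (hpq : (pq.1.1 : ℤ) - pq.1.2 = δ) (c : complexBetti X k) :
    A.typeProjDiff k δ c ∈ A.typePiece k pq := by
  rw [A.typeProjDiff_eq_typeProj pq hpq c]
  exact A.typeProj_mem k pq c

/-- **The diagonal projectors commute with a Lefschetz operator of bidegree `(1, 1)`**:
`T^δ_l (L c) = L (T^δ_k c)` for `2 + k = l` — the family `(T^δ_a)_a` is an additive family commuting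
with `L` as required by `map_internalProj_lefschetzSummand_of_commute`. [cite: VoisinHodgeI2002, §6.2.3 Rem. 6.27] -/
theorem lefschetzOperator_typeProjDiff {η : complexBetti X 2}
    (hη : ∀ (k l : ℕ) (hkl : 2 + k = l) (pq : ↥(Finset.HasAntidiagonal.antidiagonal k)) (c : complexBetti X k),
      c ∈ A.typePiece k pq → lefschetzOperator η hkl c ∈ A.typePiece l (typeShift hkl pq))
    {k l : ℕ} (hkl : 2 + k = l) (δ : ℤ) (c : complexBetti X k) :
    A.typeProjDiff l δ (lefschetzOperator η hkl c) = lefschetzOperator η hkl (A.typeProjDiff k δ c) := by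
  classical
  by_cases hex : ∃ pq : ↥(Finset.HasAntidiagonal.antidiagonal k), (pq.1.1 : ℤ) - pq.1.2 = δ
  · obtain ⟨pq, hpq⟩ := hex
    have hpq' : ((typeShift hkl pq).1.1 : ℤ) - (typeShift hkl pq).1.2 = δ := by
      simp only [typeShift]; push_cast; omega
    rw [A.typeProjDiff_eq_typeProj pq hpq, A.typeProjDiff_eq_typeProj (typeShift hkl pq) hpq',
      A.lefschetzOperator_typeProj hη hkl pq c]
  · push Not at hex
    rw [A.typeProjDiff_eq_zero hex, LinearMap.zero_apply, LinearMap.map_zero]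
    -- in degree `l` a pair with `p - q = δ` would come from one in degree `k`, unless `p = 0` or `q = 0`
    by_cases hex' : ∃ pq' : ↥(Finset.HasAntidiagonal.antidiagonal l), (pq'.1.1 : ℤ) - pq'.1.2 = δ
    · obtain ⟨pq', hpq'⟩ := hex'
      have hl := Finset.HasAntidiagonal.mem_antidiagonal.1 pq'.2
      -- `pq'` is a shift iff both coordinates are positive
      by_cases hpos : 1 ≤ pq'.1.1 ∧ 1 ≤ pq'.1.2
      · exfalso
        refine hex ⟨(pq'.1.1 - 1, pq'.1.2 - 1), Finset.HasAntidiagonal.mem_antidiagonal.2 (by omega)⟩ ?_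
        push_cast [hpos.1, hpos.2]
        omega
      · -- `p' = 0` or `q' = 0`: the piece `(p', q')` of `L c` receives nothing
        rw [A.typeProjDiff_eq_typeProj pq' hpq']
        refine (A.typeProj_eq_of_sum_eq (c := lefschetzOperator η hkl c)
          (y := fun i' ↦ ∑ i ∈ Finset.univ.filter (fun i ↦ typeShift hkl i = i'),
            lefschetzOperator η hkl (A.typeProj k i c)) (fun i' ↦ ?_) ?_ pq').trans ?_
        · refine Submodule.sum_mem _ fun i hi ↦ ?_
          rw [Finset.mem_filter] at hi
          rw [← hi.2]
          exact hη k l hkl i _ (A.typeProj_mem k i c)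
        · rw [Finset.sum_fiberwise Finset.univ (typeShift hkl)
            (fun i ↦ lefschetzOperator η hkl (A.typeProj k i c)), ← map_sum, A.sum_typeProj]
        · refine Finset.sum_eq_zero fun i hi ↦ ?_
          exfalso
          rw [Finset.mem_filter] at hi
          have h := congrArg Subtype.val hi.2
          simp only [typeShift] at h
          apply hpos
          rw [← h]
          exact ⟨by omega, by omega⟩
    · push Not at hex'
      rw [A.typeProjDiff_eq_zero hex', LinearMap.zero_apply]

end HodgeModel

end HodgeTheory

end Literature.AlgebraicGeometry.HodgeTheory
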